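import Summits.AtomisticToContinuum.FouriersLaw.Theorems.BondHeatUncertaintyBoundedResponseBathHeatSeparationB
import HarnessLib

/-!
# BondHeatUncertainty / BoundedResponse — «Separation»: the crossing defect RESOLVED BY LEVEL CLIPPING; the hub `(HRᶠ) ⟺ (SEP)` and the SIGN rung
(decomp-a2c lens-1, g114, NODE 114 «Separation / LevelSet»; blocker item stmt-AtomisticToContinuum-11071 = `BoundedResponse`; main file (part 3 of 3) of
the chain `…BathHeatSeparationA` (§1) → `…BathHeatSeparationB` (§1b–§2) → this file (§3 the route statements, §4 the doors + this overview); imports only the TREE: NODE 111 `…BathHeatHeatReturn` (the (HR) statements) and NODE 112 `…BathHeatHorizonReturnC` (measurability of kick averages))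

THE AXIS GRADED HERE IS THE PROFILE'S LEVEL, not its window (NODE 112/113) and not its horizon (NODE 112): for a profile `g` on the thermal line
`(ℝ, ν_T)`, `θ_T(k) = k² − T`, and a LEVEL `L ∈ ℝ` put
  `hotDeficit_T(L, g) := ∫ (k² − T)⁺ · (L − g(k))⁺ dν_T`   (hot kicks returning LESS than `L`),
  `coldExcess_T(L, g) := ∫ (T − k²)⁺ · (g(k) − L)⁺ dν_T`   (cold kicks returning MORE than `L`),
  `𝔙_T(L, g) := hotDeficit + coldExcess`                    (the LEVEL-SEPARATION VIOLATION).

§1–§1b (pure 1-D, files A/B) ★★ THE LEVEL FORMULA FOR NODE 110's CROSSING DEFECT: `𝔇_T(g) ≤ 𝔙_T(L, g)` for EVERY level `L` (clip `g` at `L`: `max(g, L)` on the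
hot side, `min(g, L)` on the cold side is a single-crossing comparison curve), and for EVEN `g` (every response curve of this lineage is even)
★★ `𝔇_T(g) = ⨅_L 𝔙_T(L, g)` EXACTLY (`thermalCrossDefect_eq_iInf_levelViolation`: symmetrise an admissible comparison curve; the affine slope drops out).
So the abstract cone distance of NODE 110/111 is a ONE-PARAMETER minimisation of an explicit integral — computable from a KICK table. Also: `𝔙` is
`(∫|θ_T|dν_T)`-Lipschitz in the level; `𝔙_T(0, g) = ∫ (θ_T·g)⁻ dν_T` (level `0` = the negative part of the floor's own integrand); separation at a level
(`g ≤ L` on cold kicks, `g ≥ L` on hot kicks) ⟺ violation `0`; monotone in `k²` ⟹ separated at the thermal-kick level `g(√T)`.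

§2 (file B) the chain facts; §3 (main file) ROUTE STATEMENTS on NODE 111's heat-return curve `𝔊_N = 𝔊^{aN,cN²}_N` (all `UNDECIDED · INSTRUMENTABLE · phonon-TRUE`, not
literature facts): (SEP_{a,g}) `LateHeatReturnSeparated a g` — `∃ L_N, 𝔙_T(L_N, 𝔊_N) ≤ C·N^g` («some level separates the late heat returns of the cold
kicks from those of the hot kicks, up to an `N^g` violation»); (SEP⁰_{a,g}) `LateHeatReturnSeparatedNear a g` — the same with an OHMIC level
`|L_N| ≤ C·N^g`; the two SIGNED one-sided pieces at level `0`: (HKᶠ_{a,g}) `LateHotKickFloor a g` — `hotDeficit_T(0, 𝔊_N) ≤ C·N^g` («a bath particle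
set HOTTER than thermal never leaves the contact COLDER than thermal in the late window, `ℓ`-weighted, beyond `O(N^g)`») and (CKᶜ_{a,g})
`LateColdKickCeiling a g` — `coldExcess_T(0, 𝔊_N) ≤ C·N^g` (the mirror statement for the BOUNDED family of cold kicks `k² < T` — no hard kicks at
all); and the pointwise top rung (KS_a) `LateKinResponseSigned a` — `θ_T(k)·(Ḡ_{N,u}(k) − T) ≥ 0` for every late lag `u ≥ aN` and every kick.

§4 DOORS (every arrow PROVED, `a ≥ 0`): ★★★ `LateHeatReturnFloor a g ⟺ LateHeatReturnSeparated a g` (THE HUB: NODE 111's defect floor IS separation);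
`(SEP_{a,g}) ⟹ LateTailFloor a 1 g ⟹ [g ≤ 1, with (S)] 11071`; `(HKᶠ) ∧ (CKᶜ) ⟺ (SEP⁰) ⟹ (SEP)` (the sign rung = separation at an Ohmic level; the
gap between hub and sign rung is exactly the THERMAL-KICK RETURN LEVEL `|L_N| ≫ N^g`); `(HR↑_a) ⟹ (SEP_{a,g})` for every `g` with constant `0`
(monotone ⟹ separated at `𝔊(√T)` — so (SEP) is WEAKER than the whole monotone family of NODES 110–113 and than the sign family: it is their
meet); `(KS_a) ⟹ (HKᶠ_{a,g}) ∧ (CKᶜ_{a,g})` with constant `0` AND `(KS_a) ⟹ LateKernelFloor a p α` with `A = 0` (hence NODE 109's `LateNegMass a`):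
the pointwise sign rung sits above BOTH the kick-resolved (this node) and the lag-resolved (NODE 109) negative-mass pieces, which are incomparable
with each other. The same 1-D theorem resolves NODE 110's `kinResponseDefect` (`kinResponseDefect_eq_iInf_levelViolation`).
No `sorry`, no new axioms; nothing here closes an item.
-/

noncomputable section

open MeasureTheory ProbabilityTheory Filter Topology Set Function
open scoped NNReal ENNReal
open Literature.MathematicalPhysics.KineticTheory.HeatConduction
open Literature.MathematicalPhysics.KineticTheory OscillatorChain
open Literature.Probability.Process

namespace Summit.AtomisticToContinuum.FouriersLaw.Theorems.BoundedResponse.HeatSpreading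

/-! ## §3 (NODE 114) The route statements (`UNDECIDED · INSTRUMENTABLE · phonon-TRUE`; not literature facts) -/

section Chain

variable {ω₂ lam β γ : ℝ} {T : ℝ}

/-- **(SEP_{a,g}) `LateHeatReturnSeparated a g`** — the late cumulative heat-return curve of NODE 111 is SEPARATED BY SOME LEVEL up to an
`N^g` violation: `∀ c > 0 ∃ C N₀ ∀ N ≥ N₀ ∃ L_N, 𝔙_T(L_N, 𝔊^{aN,cN²}_N) ≤ C·N^g` — «there is an energy level below which the late heat returns
of all COLD kicks stay and above which those of all HOT kicks stay, `|θ_T|ν_T`-weighted error `O(N^g)`». By the level formula this IS NODE 111's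
defect floor (HRᶠ_{a,g}) (`lateHeatReturnFloor_iff_separated`); grade `g ≤ 1` closes 11071 with (S). WEAKER than every monotone statement of
NODES 110–113 and than the sign rung below (their meet). Phonon-TRUE. `UNDECIDED · INSTRUMENTABLE` (one convex 1-D minimisation over `L` per
`(N, a, c)` from a KICK-111 table). [new · brilliant idea (the separation form)] -/
def LateHeatReturnSeparated (a g : ℝ) : Prop :=
  ∀ ω₂ lam β γ : ℝ, 0 < ω₂ → 0 < lam → 0 < β → 0 < γ → ∀ T : ℝ, 0 < T → ∀ c : ℝ, 0 < c →
    ∃ C : ℝ, ∃ N₀ : ℕ, ∀ N : ℕ, N₀ ≤ N → ∃ L : ℝ,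
      levelViolation T L (heatReturnProfile ω₂ lam β γ T N (a * N) (c * (N : ℝ) ^ 2)) ≤ C * (N : ℝ) ^ g

/-- **(SEP⁰_{a,g}) `LateHeatReturnSeparatedNear a g`** — separation at an OHMIC level: `∃ L_N, |L_N| ≤ C·N^g ∧ 𝔙_T(L_N, 𝔊_N) ≤ C·N^g`.
Equivalent to the conjunction of the two signed pieces (`lateHeatReturnSeparatedNear_iff_hot_cold`); the gap to (SEP) is exactly the size of
the separating level (the late heat return of the THERMAL kick `k² = T`, conjecturally `≫ N` in the self-trapping regime). [new · bookkeeping] -/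
def LateHeatReturnSeparatedNear (a g : ℝ) : Prop :=
  ∀ ω₂ lam β γ : ℝ, 0 < ω₂ → 0 < lam → 0 < β → 0 < γ → ∀ T : ℝ, 0 < T → ∀ c : ℝ, 0 < c →
    ∃ C : ℝ, ∃ N₀ : ℕ, ∀ N : ℕ, N₀ ≤ N → ∃ L : ℝ, |L| ≤ C * (N : ℝ) ^ g ∧
      levelViolation T L (heatReturnProfile ω₂ lam β γ T N (a * N) (c * (N : ℝ) ^ 2)) ≤ C * (N : ℝ) ^ g

/-- **(HKᶠ_{a,g}) `LateHotKickFloor a g`** — NO LATE UNDERSHOOT AFTER HOT KICKS: `hotDeficit_T(0, 𝔊^{aN,cN²}_N) ≤ C·N^g`, i.e.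
`∫_{k²>T} (k²−T)·(𝔊_N(k))⁻ dν_T = O(N^g)` — «a bath particle set HOTTER than thermal does not leave the contact kinetic temperature BELOW `T` in the
late window `[aN, cN²]` (`ℓ`-weighted time integral), beyond `O(N^g)`». One-sided (a floor, not a rate): immune to the size of the positive
self-trapped excess that threatens the monotone family. Threat: a coherent «cold echo» — the hot pulse reflected with a trailing rarefaction
refocused on the contact at `t ≍ N/v_s`, `ℓ ≍ N` there. Phonon-TRUE (harmonic `Ḡ_u − T = (k²−T)φ_N(u)² ≥ 0` on hot kicks).
`UNDECIDED · INSTRUMENTABLE` (sign-resolved KICK table). [new · brilliant idea] -/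
def LateHotKickFloor (a g : ℝ) : Prop :=
  ∀ ω₂ lam β γ : ℝ, 0 < ω₂ → 0 < lam → 0 < β → 0 < γ → ∀ T : ℝ, 0 < T → ∀ c : ℝ, 0 < c →
    ∃ C : ℝ, ∃ N₀ : ℕ, ∀ N : ℕ, N₀ ≤ N →
      hotDeficit T 0 (heatReturnProfile ω₂ lam β γ T N (a * N) (c * (N : ℝ) ^ 2)) ≤ C * (N : ℝ) ^ g

/-- **(CKᶜ_{a,g}) `LateColdKickCeiling a g`** — NO LATE OVERSHOOT AFTER COLD KICKS: `coldExcess_T(0, 𝔊^{aN,cN²}_N) ≤ C·N^g` — «a bath particle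
set COLDER than thermal (`k² < T`: a BOUNDED family of perturbations, energy deficit `≤ T/2`) does not leave the contact HOTTER than `T` late,
beyond `O(N^g)`». The small-perturbation half: no hard kicks, no breathers are created; threat: the mirror «hot echo» of the rarefaction pulse.
Phonon-TRUE. `UNDECIDED · INSTRUMENTABLE`. [new · brilliant idea] -/
def LateColdKickCeiling (a g : ℝ) : Prop :=
  ∀ ω₂ lam β γ : ℝ, 0 < ω₂ → 0 < lam → 0 < β → 0 < γ → ∀ T : ℝ, 0 < T → ∀ c : ℝ, 0 < c →
    ∃ C : ℝ, ∃ N₀ : ℕ, ∀ N : ℕ, N₀ ≤ N →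
      coldExcess T 0 (heatReturnProfile ω₂ lam β γ T N (a * N) (c * (N : ℝ) ^ 2)) ≤ C * (N : ℝ) ^ g

/-- **(KS_a) `LateKinResponseSigned a`** — THE SIGN RUNG (pointwise, kick- and lag-resolved): `θ_T(k)·(Ḡ_{N,u}(k) − T) ≥ 0` for all late lags
`u ≥ aN` and all kicks — «after the light cone the contact is never colder than thermal following a hot kick, never hotter following a cold
one». Implies (HKᶠ), (CKᶜ) with constant `0` AND NODE 109's pointwise kernel floor with `A = 0` (`K_N(u) = ∫ θ_T(Ḡ_u − T) dν_T ≥ 0`), hence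
`LateNegMass a`: it sits above both negative-mass families. INCOMPARABLE with (G↑): a signed curve need not be monotone and a monotone curve
is signed only about ITS thermal-kick level `Ḡ_u(√T)`, not about `T`. FALSE at early lags is irrelevant (`u ≥ aN` only); the late threat is the
echo. Phonon-TRUE. `UNDECIDED · INSTRUMENTABLE`. [new · bookkeeping] -/
def LateKinResponseSigned (a : ℝ) : Prop :=
  ∀ ω₂ lam β γ : ℝ, 0 < ω₂ → 0 < lam → 0 < β → 0 < γ → ∀ T : ℝ, 0 < T →
    ∃ N₀ : ℕ, ∀ N : ℕ, N₀ ≤ N → ∀ u : ℝ, a * N ≤ u → ∀ k : ℝ,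
      0 ≤ (k ^ 2 - T) * (kinKickProfile ω₂ lam β γ T N u k - T)

/-! ## §4 (NODE 114) Doors: the hub, the signed pieces, the sign rung, the ladder -/

/-- ★★★ **THE HUB: `LateHeatReturnFloor a g ⟺ LateHeatReturnSeparated a g`** (`a ≥ 0`) — NODE 111's defect floor, the weakest door beneath
the residual of record, IS a level-separation statement (`→`: near-optimal levels, `ε = N^g`; `←`: the level bound). [this cell] -/
theorem lateHeatReturnFloor_iff_separated {a g : ℝ} (ha : 0 ≤ a) :
    LateHeatReturnFloor a g ↔ LateHeatReturnSeparated a g := by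
  constructor
  · intro h ω₂ lam β γ hω hl hβ hγ T hT c hc
    obtain ⟨C, N₀, hC⟩ := h ω₂ lam β γ hω hl hβ hγ T hT c hc
    refine ⟨C + 1, N₀ + 1, fun N hN => ?_⟩
    obtain ⟨n, rfl⟩ : ∃ n, N = n + 1 := ⟨N - 1, by omega⟩
    have hs : 0 ≤ a * ((n + 1 : ℕ) : ℝ) := by positivity
    have ht : 0 ≤ c * ((n + 1 : ℕ) : ℝ) ^ 2 := by positivity
    obtain ⟨he, hm, hI⟩ := heatReturnProfile_levelFacts hω hl hβ hγ hT n hs ht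
    have hNg : 0 < ((n + 1 : ℕ) : ℝ) ^ g := Real.rpow_pos_of_pos (by positivity) g
    obtain ⟨L, hL⟩ := exists_levelViolation_lt he hm hI hNg
    refine ⟨L, ?_⟩
    have hD := hC (n + 1) (by omega)
    have e : (C + 1) * ((n + 1 : ℕ) : ℝ) ^ g = C * ((n + 1 : ℕ) : ℝ) ^ g + ((n + 1 : ℕ) : ℝ) ^ g := by ring
    linarith
  · intro h ω₂ lam β γ hω hl hβ hγ T hT c hc
    obtain ⟨C, N₀, hC⟩ := h ω₂ lam β γ hω hl hβ hγ T hT c hc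
    refine ⟨C, N₀ + 1, fun N hN => ?_⟩
    obtain ⟨n, rfl⟩ : ∃ n, N = n + 1 := ⟨N - 1, by omega⟩
    have hs : 0 ≤ a * ((n + 1 : ℕ) : ℝ) := by positivity
    have ht : 0 ≤ c * ((n + 1 : ℕ) : ℝ) ^ 2 := by positivity
    obtain ⟨-, hm, hI⟩ := heatReturnProfile_levelFacts hω hl hβ hγ hT n hs ht
    obtain ⟨L, hL⟩ := hC (n + 1) (by omega)
    exact (thermalCrossDefect_le_levelViolation hm hI L).trans hL

/-- ★ Grade monotonicity of (SEP). [formal bookkeeping] -/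
theorem lateHeatReturnSeparated_mono {a g g' : ℝ} (ha : 0 ≤ a) (hgg' : g ≤ g') (h : LateHeatReturnSeparated a g) :
    LateHeatReturnSeparated a g' :=
  (lateHeatReturnFloor_iff_separated ha).1 (lateHeatReturnFloor_mono hgg' ((lateHeatReturnFloor_iff_separated ha).2 h))

/-- ★★ **(SEP_{a,g}) ⟹ `LateTailFloor a 1 g`** (`a ≥ 0`). [this cell] -/
theorem lateTailFloor_of_lateHeatReturnSeparated {a g : ℝ} (ha : 0 ≤ a) (h : LateHeatReturnSeparated a g) : LateTailFloor a 1 g :=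
  lateTailFloor_of_lateHeatReturnFloor ha ((lateHeatReturnFloor_iff_separated ha).2 h)

open Summit.AtomisticToContinuum.FouriersLaw.Theses.BondHeatUncertainty (BoundedResponse SubdiffusiveBondHeat)

/-- ★★ **(S) ∧ (SEP_{a,g}) ⟹ 11071** for `g ≤ 1`, `a ≥ 0`. [this cell] -/
theorem boundedResponse_of_subdiffusiveBondHeat_lateHeatReturnSeparated {a g : ℝ} (ha : 0 ≤ a) (hg : g ≤ 1)
    (hS : SubdiffusiveBondHeat) (h : LateHeatReturnSeparated a g) : BoundedResponse :=
  boundedResponse_of_subdiffusiveBondHeat_lateHeatReturnFloor ha hg hS ((lateHeatReturnFloor_iff_separated ha).2 h)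

/-- ★ **(HR↑_a) ⟹ (SEP_{a,g}) for EVERY grade `g`, constant `0`**: a monotone curve is separated at its thermal-kick level (no `a ≥ 0` needed).
[this cell] -/
theorem lateHeatReturnSeparated_of_monotone {a : ℝ} (h : LateHeatReturnMonotone a) (g : ℝ) : LateHeatReturnSeparated a g := by
  intro ω₂ lam β γ hω hl hβ hγ T hT c hc
  obtain ⟨N₀, hN₀⟩ := h ω₂ lam β γ hω hl hβ hγ T hT c hc
  refine ⟨0, N₀, fun N hN => ?_⟩
  obtain ⟨R, hmono, hae⟩ := hN₀ N hN
  refine ⟨R (Real.sqrt T), ?_⟩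
  rw [levelViolation_congr_ae hae, levelViolation_eq_zero_of_monotoneSq hT.le hmono, zero_mul]

/-- ★ (SEP⁰) ⟹ (SEP) (drop the level budget). [formal bookkeeping] -/
theorem lateHeatReturnSeparated_of_near {a g : ℝ} (h : LateHeatReturnSeparatedNear a g) : LateHeatReturnSeparated a g := by
  intro ω₂ lam β γ hω hl hβ hγ T hT c hc
  obtain ⟨C, N₀, hC⟩ := h ω₂ lam β γ hω hl hβ hγ T hT c hc
  exact ⟨C, N₀, fun N hN => by obtain ⟨L, -, hL⟩ := hC N hN; exact ⟨L, hL⟩⟩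

/-- ★★ **(SEP⁰_{a,g}) ⟺ (HKᶠ_{a,g}) ∧ (CKᶜ_{a,g})** (`a ≥ 0`): separation at an Ohmic level is exactly the two signed pieces at level `0`
(`→`: the Lipschitz bound moves the level to `0` at cost `|L_N|·∫|θ_T| = O(N^g)`; `←`: `𝔙_T(0,·) = hotDeficit + coldExcess`). [this cell] -/
theorem lateHeatReturnSeparatedNear_iff_hot_cold {a g : ℝ} (ha : 0 ≤ a) :
    LateHeatReturnSeparatedNear a g ↔ LateHotKickFloor a g ∧ LateColdKickCeiling a g := by
  constructor
  · intro h
    have key : ∀ ω₂ lam β γ : ℝ, 0 < ω₂ → 0 < lam → 0 < β → 0 < γ → ∀ T : ℝ, 0 < T → ∀ c : ℝ, 0 < c →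
        ∃ C : ℝ, ∃ N₀ : ℕ, ∀ N : ℕ, N₀ ≤ N →
          levelViolation T 0 (heatReturnProfile ω₂ lam β γ T N (a * N) (c * (N : ℝ) ^ 2)) ≤ C * (N : ℝ) ^ g := by
      intro ω₂ lam β γ hω hl hβ hγ T hT c hc
      obtain ⟨C, N₀, hC⟩ := h ω₂ lam β γ hω hl hβ hγ T hT c hc
      set Kθ : ℝ := ∫ k, |k ^ 2 - T| ∂(gaussianReal 0 T.toNNReal) with hKθdef
      refine ⟨C + C * Kθ, N₀ + 1, fun N hN => ?_⟩
      obtain ⟨n, rfl⟩ : ∃ n, N = n + 1 := ⟨N - 1, by omega⟩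
      have hs : 0 ≤ a * ((n + 1 : ℕ) : ℝ) := by positivity
      have ht : 0 ≤ c * ((n + 1 : ℕ) : ℝ) ^ 2 := by positivity
      obtain ⟨-, hm, hI⟩ := heatReturnProfile_levelFacts hω hl hβ hγ hT n hs ht
      obtain ⟨L, hLabs, hL⟩ := hC (n + 1) (by omega)
      have hlip := levelViolation_le_add_mul hm hI 0 L
      rw [zero_sub, abs_neg] at hlip
      have hKθ : 0 ≤ Kθ := integral_nonneg fun _ => abs_nonneg _
      have h3 : |L| * Kθ ≤ C * ((n + 1 : ℕ) : ℝ) ^ g * Kθ := mul_le_mul_of_nonneg_right hLabs hKθ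
      have e : (C + C * Kθ) * ((n + 1 : ℕ) : ℝ) ^ g = C * ((n + 1 : ℕ) : ℝ) ^ g + C * ((n + 1 : ℕ) : ℝ) ^ g * Kθ := by ring
      linarith
    constructor
    · intro ω₂ lam β γ hω hl hβ hγ T hT c hc
      obtain ⟨C, N₀, hC⟩ := key ω₂ lam β γ hω hl hβ hγ T hT c hc
      exact ⟨C, N₀, fun N hN => (le_add_of_nonneg_right (coldExcess_nonneg _ _ _)).trans (hC N hN)⟩
    · intro ω₂ lam β γ hω hl hβ hγ T hT c hc
      obtain ⟨C, N₀, hC⟩ := key ω₂ lam β γ hω hl hβ hγ T hT c hc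
      exact ⟨C, N₀, fun N hN => (le_add_of_nonneg_left (hotDeficit_nonneg _ _ _)).trans (hC N hN)⟩
  · rintro ⟨hH, hK⟩ ω₂ lam β γ hω hl hβ hγ T hT c hc
    obtain ⟨C₁, N₁, h₁⟩ := hH ω₂ lam β γ hω hl hβ hγ T hT c hc
    obtain ⟨C₂, N₂, h₂⟩ := hK ω₂ lam β γ hω hl hβ hγ T hT c hc
    refine ⟨max (C₁ + C₂) 0, max N₁ N₂, fun N hN => ⟨0, ?_, ?_⟩⟩
    · rw [abs_zero]
      exact mul_nonneg (le_max_right _ _) (Real.rpow_nonneg (Nat.cast_nonneg N) g)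
    · calc levelViolation T 0 (heatReturnProfile ω₂ lam β γ T N (a * N) (c * (N : ℝ) ^ 2))
          ≤ C₁ * (N : ℝ) ^ g + C₂ * (N : ℝ) ^ g :=
            add_le_add (h₁ N (le_of_max_le_left hN)) (h₂ N (le_of_max_le_right hN))
        _ = (C₁ + C₂) * (N : ℝ) ^ g := by ring
        _ ≤ max (C₁ + C₂) 0 * (N : ℝ) ^ g :=
            mul_le_mul_of_nonneg_right (le_max_left _ _) (Real.rpow_nonneg (Nat.cast_nonneg N) g)

/-- ★ **(HKᶠ) ∧ (CKᶜ) ⟹ (SEP)**, hence `⟹ LateTailFloor a 1 g ⟹ [g ≤ 1, (S)] 11071`. [this cell] -/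
theorem lateHeatReturnSeparated_of_hot_cold {a g : ℝ} (ha : 0 ≤ a) (hH : LateHotKickFloor a g) (hK : LateColdKickCeiling a g) :
    LateHeatReturnSeparated a g :=
  lateHeatReturnSeparated_of_near ((lateHeatReturnSeparatedNear_iff_hot_cold ha).2 ⟨hH, hK⟩)

/-- ★★ **(S) ∧ (HKᶠ_{a,g}) ∧ (CKᶜ_{a,g}) ⟹ 11071** (`g ≤ 1`, `a ≥ 0`): the two signed kick statements close the blocker given (S). [this cell] -/
theorem boundedResponse_of_subdiffusiveBondHeat_hot_cold {a g : ℝ} (ha : 0 ≤ a) (hg : g ≤ 1) (hS : SubdiffusiveBondHeat)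
    (hH : LateHotKickFloor a g) (hK : LateColdKickCeiling a g) : BoundedResponse :=
  boundedResponse_of_subdiffusiveBondHeat_lateHeatReturnSeparated ha hg hS (lateHeatReturnSeparated_of_hot_cold ha hH hK)

/-- **Sign coherence of the kick curves integrates to sign coherence of the heat-return curve** (`0 ≤ s`, `2s ≤ t`: `ℓ ≥ 0`):
`θ_T(k)·𝔊^{s,t}(k) = ∫_{(s,∞)} ℓ(u)·θ_T(k)(Ḡ_u(k) − T) du ≥ 0`. [this cell] -/
theorem sqSub_mul_heatReturnProfile_nonneg (hω : 0 < ω₂) (hl : 0 < lam) (hβ : 0 < β) (hγ : 0 < γ) (hT : 0 < T) (n : ℕ)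
    {s t : ℝ} (hs : 0 ≤ s) (hst : 2 * s ≤ t)
    (hsign : ∀ u : ℝ, s ≤ u → ∀ k : ℝ, 0 ≤ (k ^ 2 - T) * (kinKickProfile ω₂ lam β γ T (n + 1) u k - T)) (k : ℝ) :
    0 ≤ (k ^ 2 - T) * heatReturnProfile ω₂ lam β γ T (n + 1) s t k := by
  have hst' : s ≤ t := by linarith
  rw [heatReturnProfile_eq_setIntegral_Ioi hω hl hβ hγ hT n hs hst' k, ← integral_const_mul]
  refine setIntegral_nonneg measurableSet_Ioi fun u hu => ?_
  have hu : s < u := hu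
  rw [show (k ^ 2 - T) * (lateWeight s t u * (kinKickProfile ω₂ lam β γ T (n + 1) u k - T)) =
    lateWeight s t u * ((k ^ 2 - T) * (kinKickProfile ω₂ lam β γ T (n + 1) u k - T)) by ring]
  exact mul_nonneg (lateWeight_nonneg hs hst (hs.trans hu.le)) (hsign u hu.le k)

/-- **A sign-coherent curve has no level-`0` violation.** [formal bookkeeping] -/
theorem hotDeficit_coldExcess_zero_of_sign {g : ℝ → ℝ} (hsign : ∀ k : ℝ, 0 ≤ (k ^ 2 - T) * g k) :
    hotDeficit T 0 g = 0 ∧ coldExcess T 0 g = 0 := by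
  have h := levelViolation_eq_zero_of_separated (T := T) (L := 0) (g := g)
    (fun k hk => by have := hsign k; by_contra hcon; push Not at hcon; nlinarith)
    (fun k hk => by have := hsign k; by_contra hcon; push Not at hcon; nlinarith)
  exact ⟨h.1, h.2.1⟩

/-- ★★ **(KS_a) ⟹ (HKᶠ_{a,g}) ∧ (CKᶜ_{a,g}) for every `g`, constant `0`** (`a ≥ 0`; eventually `2aN ≤ cN²`). [this cell] -/
theorem lateHotKickFloor_coldKickCeiling_of_signed {a : ℝ} (ha : 0 ≤ a) (h : LateKinResponseSigned a) (g : ℝ) :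
    LateHotKickFloor a g ∧ LateColdKickCeiling a g := by
  have key : ∀ ω₂ lam β γ : ℝ, 0 < ω₂ → 0 < lam → 0 < β → 0 < γ → ∀ T : ℝ, 0 < T → ∀ c : ℝ, 0 < c →
      ∃ N₀ : ℕ, ∀ N : ℕ, N₀ ≤ N →
        hotDeficit T 0 (heatReturnProfile ω₂ lam β γ T N (a * N) (c * (N : ℝ) ^ 2)) = 0 ∧
          coldExcess T 0 (heatReturnProfile ω₂ lam β γ T N (a * N) (c * (N : ℝ) ^ 2)) = 0 := by
    intro ω₂ lam β γ hω hl hβ hγ T hT c hc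
    obtain ⟨N₀, hN₀⟩ := h ω₂ lam β γ hω hl hβ hγ T hT
    obtain ⟨N₁, hN₁⟩ := exists_nat_ge (2 * a / c)
    refine ⟨max N₀ N₁ + 1, fun N hN => ?_⟩
    obtain ⟨n, rfl⟩ : ∃ n, N = n + 1 := ⟨N - 1, by omega⟩
    have hs : 0 ≤ a * ((n + 1 : ℕ) : ℝ) := by positivity
    have hN1' : (N₁ : ℝ) ≤ ((n + 1 : ℕ) : ℝ) := by exact_mod_cast (show N₁ ≤ n + 1 by omega)
    have hNpos : (0 : ℝ) ≤ ((n + 1 : ℕ) : ℝ) := by positivity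
    have h2 : 2 * a ≤ ((n + 1 : ℕ) : ℝ) * c := (div_le_iff₀ hc).1 (hN₁.trans hN1')
    have hst : 2 * (a * ((n + 1 : ℕ) : ℝ)) ≤ c * ((n + 1 : ℕ) : ℝ) ^ 2 := by nlinarith
    exact hotDeficit_coldExcess_zero_of_sign fun k =>
      sqSub_mul_heatReturnProfile_nonneg hω hl hβ hγ hT n hs hst (fun u hu k' => hN₀ (n + 1) (by omega) u hu k') k
  constructor
  · intro ω₂ lam β γ hω hl hβ hγ T hT c hc
    obtain ⟨N₀, hN₀⟩ := key ω₂ lam β γ hω hl hβ hγ T hT c hc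
    exact ⟨0, N₀, fun N hN => by rw [(hN₀ N hN).1, zero_mul]⟩
  · intro ω₂ lam β γ hω hl hβ hγ T hT c hc
    obtain ⟨N₀, hN₀⟩ := key ω₂ lam β γ hω hl hβ hγ T hT c hc
    exact ⟨0, N₀, fun N hN => by rw [(hN₀ N hN).2, zero_mul]⟩

/-- ★ **(KS_a) ⟹ (SEP_{a,g})** for every `g` (`a ≥ 0`). [this cell] -/
theorem lateHeatReturnSeparated_of_signed {a : ℝ} (ha : 0 ≤ a) (h : LateKinResponseSigned a) (g : ℝ) :
    LateHeatReturnSeparated a g :=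
  lateHeatReturnSeparated_of_hot_cold ha (lateHotKickFloor_coldKickCeiling_of_signed ha h g).1
    (lateHotKickFloor_coldKickCeiling_of_signed ha h g).2

/-- **A sign-coherent response curve has a nonnegative kernel value**: `K_{n+1}(u) = ∫ θ_T·(Ḡ_u − T) dν_T ≥ 0` (`∫ θ_T dν_T = 0`). [this cell] -/
theorem bathKinCorr_nonneg_of_sign (hω : 0 < ω₂) (hl : 0 < lam) (hβ : 0 < β) (hγ : 0 < γ) (hT : 0 < T) (n : ℕ) {u : ℝ}
    (hsign : ∀ k : ℝ, 0 ≤ (k ^ 2 - T) * (kinKickProfile ω₂ lam β γ T (n + 1) u k - T)) :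
    0 ≤ bathKinCorr ω₂ lam β γ T (n + 1) u := by
  obtain ⟨hI, e⟩ := bathKinCorr_eq_integral_kinKickProfile hω hl hβ hγ hT n u
  have h0 : ∫ k, (k ^ 2 - T) * T ∂(gaussianReal 0 T.toNNReal) = 0 := by
    have h := gaussT_integral_sqSub_mul_affine hT.le T 0
    simpa using h
  have hI2 : Integrable (fun k : ℝ => (k ^ 2 - T) * T) (gaussianReal 0 T.toNNReal) := (gaussT_integrable_sqSub T).mul_const T
  have hI3 : Integrable (fun k : ℝ => (k ^ 2 - T) * (kinKickProfile ω₂ lam β γ T (n + 1) u k - T)) (gaussianReal 0 T.toNNReal) := by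
    refine (hI.sub hI2).congr (ae_of_all _ fun k => ?_)
    simp only [Pi.sub_apply]
    ring
  have hsplit : ∫ k, (k ^ 2 - T) * kinKickProfile ω₂ lam β γ T (n + 1) u k ∂(gaussianReal 0 T.toNNReal) =
      ∫ k, ((k ^ 2 - T) * (kinKickProfile ω₂ lam β γ T (n + 1) u k - T) + (k ^ 2 - T) * T) ∂(gaussianReal 0 T.toNNReal) :=
    integral_congr_ae (ae_of_all _ fun k => by ring)
  rw [e, hsplit, integral_add hI3 hI2, h0, add_zero]
  exact integral_nonneg hsign

/-- ★★ **(KS_a) ⟹ `LateKernelFloor a p α` with `A = 0` for every `(p, α)`**, hence NODE 109's `LateNegMass a`: the sign rung sits above the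
lag-resolved negative-mass family too. [this cell] -/
theorem lateKernelFloor_of_signed {a : ℝ} (h : LateKinResponseSigned a) (p α : ℝ) : LateKernelFloor a p α := by
  intro ω₂ lam β γ hω hl hβ hγ T hT
  obtain ⟨N₀, hN₀⟩ := h ω₂ lam β γ hω hl hβ hγ T hT
  refine ⟨0, N₀ + 1, fun N hN r hr => ?_⟩
  obtain ⟨n, rfl⟩ : ∃ n, N = n + 1 := ⟨N - 1, by omega⟩
  rw [zero_mul, zero_mul, neg_zero]
  exact bathKinCorr_nonneg_of_sign hω hl hβ hγ hT n (hN₀ (n + 1) (by omega) r hr)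

/-- ★ **SIGN COHERENCE = SEPARATION AT THE THERMAL LEVEL `T`**: a signed response curve has `𝔙_T(T, Ḡ_u) = 0`, hence `𝔇_N(u) = 0`; so
`(KS_a) ⟹ LateKinResponseFloor a p α` with `A = 0` for every `(p, α)` (NODE 110's graded defect floor) as well. [this cell] -/
theorem lateKinResponseFloor_of_signed {a : ℝ} (h : LateKinResponseSigned a) (p α : ℝ) : LateKinResponseFloor a p α := by
  intro ω₂ lam β γ hω hl hβ hγ T hT
  obtain ⟨N₀, hN₀⟩ := h ω₂ lam β γ hω hl hβ hγ T hT
  refine ⟨0, N₀ + 1, fun N hN u hu => ?_⟩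
  obtain ⟨n, rfl⟩ : ∃ n, N = n + 1 := ⟨N - 1, by omega⟩
  obtain ⟨-, hm, hI⟩ := kinKickProfile_levelFacts hω hl hβ hγ hT n u
  have hsign := hN₀ (n + 1) (by omega) u hu
  have hsep := (levelViolation_eq_zero_of_separated (T := T) (L := T) (g := kinKickProfile ω₂ lam β γ T (n + 1) u)
    (fun k hk => by have := hsign k; by_contra hcon; push Not at hcon; nlinarith)
    (fun k hk => by have := hsign k; by_contra hcon; push Not at hcon; nlinarith)).2.2
  rw [zero_mul, zero_mul]
  unfold kinResponseDefect
  exact (thermalCrossDefect_le_levelViolation hm hI T).trans hsep.le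

/-- `lateNegMass_of_signed` (docstring added by the landing lane; see the module docstring). [formal bookkeeping] -/
theorem lateNegMass_of_signed {a : ℝ} (ha : 0 < a) (h : LateKinResponseSigned a) : LateNegMass a :=
  lateNegMass_of_lateKernelFloor_of_two_lt (p := 0) (α := 3) ha (by norm_num) (by norm_num) (lateKernelFloor_of_signed h 0 3)

/-- ★★ **(S) ∧ (KS_a) ⟹ 11071** (`a ≥ 0`). [this cell] -/
theorem boundedResponse_of_subdiffusiveBondHeat_signed {a : ℝ} (ha : 0 ≤ a) (hS : SubdiffusiveBondHeat)
    (h : LateKinResponseSigned a) : BoundedResponse :=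
  boundedResponse_of_subdiffusiveBondHeat_lateHeatReturnSeparated ha le_rfl hS (lateHeatReturnSeparated_of_signed ha h 1)

/-- ★★★ **THE SEPARATION LADDER (NODE 114)**, `a > 0`, `g ≤ 1`:
`(KS_a) ⟹ (HKᶠ_{a,g}) ∧ (CKᶜ_{a,g}) ⟺ (SEP⁰_{a,g}) ⟹ (SEP_{a,g}) ⟺ (HRᶠ_{a,g}) ⟹ LateTailFloor a 1 g ⟹ [with (S)] 11071`,
with the monotone family entering at (SEP): `(HR↑_a) ⟹ (SEP_{a,g})`, and the sign rung feeding NODE 109 as well: `(KS_a) ⟹ LateNegMass a`.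
[this cell] -/
theorem separation_ladder {a g : ℝ} (ha : 0 < a) (hg : g ≤ 1) :
    (LateKinResponseSigned a → LateHotKickFloor a g ∧ LateColdKickCeiling a g) ∧
      (LateHotKickFloor a g ∧ LateColdKickCeiling a g ↔ LateHeatReturnSeparatedNear a g) ∧
      (LateHeatReturnSeparatedNear a g → LateHeatReturnSeparated a g) ∧
      (LateHeatReturnSeparated a g ↔ LateHeatReturnFloor a g) ∧
      (LateHeatReturnMonotone a → LateHeatReturnSeparated a g) ∧
      (LateHeatReturnSeparated a g → LateTailFloor a 1 g) ∧
      (LateKinResponseSigned a → LateNegMass a) ∧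
      (SubdiffusiveBondHeat → LateHeatReturnSeparated a g → BoundedResponse) :=
  ⟨fun h => lateHotKickFloor_coldKickCeiling_of_signed ha.le h g,
    (lateHeatReturnSeparatedNear_iff_hot_cold ha.le).symm,
    lateHeatReturnSeparated_of_near,
    (lateHeatReturnFloor_iff_separated ha.le).symm,
    fun h => lateHeatReturnSeparated_of_monotone h g,
    lateTailFloor_of_lateHeatReturnSeparated ha.le,
    lateNegMass_of_signed ha,
    fun hS h => boundedResponse_of_subdiffusiveBondHeat_lateHeatReturnSeparated ha.le hg hS h⟩

end Chain

end Summit.AtomisticToContinuum.FouriersLaw.Theorems.BoundedResponse.HeatSpreading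

end
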